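import Summits.ResolutionOfSingularities.ResolutionOfSingularities.Theorems.MarkedTransferCampaignW46MohWindowSurfaceHeavyThread
import HarnessLib

/-!
# [OURS · L1 W4.6 rung (iii-2), EVERY `p`] Surface Moh window — THE STALLING THREAD: an infinite permissible sequence inside the
# coefficient surface-window regime carries a branch of singular points along which, infinitely often, the branch point IS the
# centre AND the residual order does NOT drop (cell res-hironaka, LADDER-RESOLUTION rung L, D-0089; seat res-L1-s46-pv-5 gen 5; host
# MarkedTransfer, `--supports stmt-ResolutionOfSingularities-16155 --as helper`; statement file `…CampaignW46MohWindowSurface.lean`)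

HONEST FRAMING. Nothing here is a statement of H. Hironaka's manuscript [Hironaka2017] and nothing here asserts that any
statement of it holds. THEOREM about the OURS regime `CampaignW46.Regime.mohWindowSurface` (o1 §5; every `p`, every `K`), sharpening
`PermissibleRun.exists_heavy_thread` (`…HeavyThread.lean`): along the centre thread `b` of `…CentreThread.lean` the residual order
`v_k = residualOrder(J_{b_k})` is constant while `b_k` is not blown up (res-D-pv-050's transport law) and lies in the finite window
`(p, 2p)`; so it cannot drop at all but finitely many of the (infinitely many) hits — infinitely often the thread is blown up with
`v_{k+1} ≥ v_k`: a STALL (`=`, res-D-pv-008's stall witnesses) or a GROWTH (`>`, res-D-pv-008's growth/doubling witnesses, bounded by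
res-D-pv-050's `v_{k+1} + p ≤ 2 v_k`). Such hits are automatically HEAVY (tame centres drop, `residualOrder_lt_of_over_tame_centre`).
This is the precise scheme-level shape of the «kangaroo» obstruction the (H2) programme must exclude for `p ≥ 3`. AI-written; AI review
is weaker than expert review. No `sorry`; axioms standard.

WHAT IS PROVED.
* `PermissibleRun.exists_stalling_thread` — a branch of singular points `b` (`b_k ∈ Sing(E_k)`, `π_k b_{k+1} = b_k`) such that for
  infinitely many `k`: `b_k ∈ D_k` and `residualOrder(J_{b_{k+1}}) ≥ residualOrder(J_{b_k})` (as naturals), and then `J_{b_k}` is not tame.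
[ZariskiSamuel1960] [Matsumura1987] [HauserWagner2014]
-/

noncomputable section

set_option linter.dupNamespace false -- mandated namespace of this single-conjunct summit

open CategoryTheory AlgebraicGeometry TopologicalSpace IsLocalRing

namespace Summit.ResolutionOfSingularities.ResolutionOfSingularities.Theorems

namespace CampaignW46

open Literature.AlgebraicGeometry.Resolution
open Literature.AlgebraicGeometry.Hironaka2017.S02Preliminaries
open Literature.AlgebraicGeometry.Hironaka2017.Datum
open Scheme.IdealSheafData

universe u

variable {p : ℕ} [Fact p.Prime] {K : Type u} [Field K] [CharP K p]

/-- **[OURS · L1 W4.6 rung (iii-2), every `p`] THE STALLING THREAD.** Let `r` be an infinite §2.1-permissible sequence all of whose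
stages lie in `Regime.mohWindowSurface`. Then there is a branch of singular points `b_k ∈ Sing(E_k)`, `π_k(b_{k+1}) = b_k`, such that
for every `k₀` there is `k ≥ k₀` at which `b_k` IS the centre, the residual order along the branch does NOT drop
(`residualOrder(J_{b_{k+1}}) ≥ residualOrder(J_{b_k})`), and (consequently) `J_{b_k}` is NOT tame. NOT a statement of the manuscript.
[folklore] -/
theorem PermissibleRun.exists_stalling_thread (r : PermissibleRun p K) (hr : ∀ k, Regime.mohWindowSurface (r.A k) (r.E k)) :
    ∃ b : ∀ k, (r.A k).Z, (∀ k, b k ∈ (r.E k).sing) ∧ (∀ k, (r.π k).base (b (k + 1)) = b k) ∧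
      ∀ k₀, ∃ k, k₀ ≤ k ∧ b k ∈ (r.D k : Set (r.A k).Z) ∧
        (residualOrder (r.E k).b ((r.A k).Z.presheaf.stalk (b k)) (stalkIdeal (r.E k).J (b k))).toNat ≤
          (residualOrder (r.E (k + 1)).b ((r.A (k + 1)).Z.presheaf.stalk (b (k + 1))) (stalkIdeal (r.E (k + 1)).J (b (k + 1)))).toNat ∧
        ¬ MohWindowSurfaceTameAt (r.E k).b ((r.A k).Z.presheaf.stalk (b k)) (stalkIdeal (r.E k).J (b k)) := by
  classical
  obtain ⟨b, hbS, hbπ, hhit⟩ := r.exists_centre_thread (fun k => (hr k).2.1) (fun k => (hr k).2.2.1)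
  refine ⟨b, hbS, hbπ, fun k₀ => ?_⟩
  -- the residual order along the branch
  let v : ℕ → ℕ := fun k => (residualOrder (r.E k).b ((r.A k).Z.presheaf.stalk (b k)) (stalkIdeal (r.E k).J (b k))).toNat
  -- one step, stated for an arbitrary next stage `E₁ = transform` (dependent rewriting along `E_succ`)
  have key : ∀ k (E₁ : IdealExponent (r.A (k + 1)).Z) (heq : E₁ = (r.E k).transform (r.π k) (r.D k))
      (h₁ : Regime.mohWindowSurface (r.A (k + 1)) E₁) (hb₁ : b (k + 1) ∈ E₁.sing),
      ((b k ∉ (r.D k : Set (r.A k).Z)) →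
        (residualOrder E₁.b ((r.A (k + 1)).Z.presheaf.stalk (b (k + 1))) (stalkIdeal E₁.J (b (k + 1)))).toNat = v k) ∧
      ((b k ∈ (r.D k : Set (r.A k).Z)) →
        (∀ ξ ∈ (r.D k : Set (r.A k).Z), MohWindowSurfaceTameAt (r.E k).b ((r.A k).Z.presheaf.stalk ξ) (stalkIdeal (r.E k).J ξ)) →
        (residualOrder E₁.b ((r.A (k + 1)).Z.presheaf.stalk (b (k + 1))) (stalkIdeal E₁.J (b (k + 1)))).toNat < v k) := by
    intro k E₁ heq h₁ hb₁
    subst heq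
    refine ⟨fun hnot => ?_, fun hin htame => ?_⟩
    · have hover : (r.π k).base (b (k + 1)) ∉ (r.D k : Set (r.A k).Z) := by rw [hbπ k]; exact hnot
      have := congrArg ENat.toNat
        (MohWindowSurfacePermissible.residualOrder_eq_of_not_over_centre (E := r.E k) (r.π k) (r.blowup k) hover)
      rwa [hbπ k] at this
    · have hover : (r.π k).base (b (k + 1)) ∈ (r.D k : Set (r.A k).Z) := by rw [hbπ k]; exact hin
      have := residualOrder_lt_of_over_tame_centre (r.π k) (r.blowup k) (r.permissible k) (hr k) h₁ htame hb₁ hover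
      rwa [hbπ k] at this
  have hcentre : ∀ k, b k ∈ (r.D k : Set (r.A k).Z) → ∀ ξ ∈ (r.D k : Set (r.A k).Z), ξ = b k := by
    intro k hbk ξ hξ
    obtain ⟨ξ₀, -, -, hD⟩ := IsPermissibleCentre.exists_eq_singleton_of_isolatedSing (r.permissible k) ⟨(hr k).2.1, (hr k).2.2.1⟩
    rw [hD] at hbk hξ
    rw [Set.mem_singleton_iff.mp hbk, Set.mem_singleton_iff.mp hξ]
  -- transport off the centre, as an equality of `v`
  have htrans : ∀ k, b k ∉ (r.D k : Set (r.A k).Z) → v (k + 1) = v k := fun k hbk =>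
    (key k (r.E (k + 1)) (r.E_succ k) (hr (k + 1)) (hbS (k + 1))).1 hbk
  -- a non-dropping hit is heavy
  have hheavy : ∀ k, b k ∈ (r.D k : Set (r.A k).Z) → v k ≤ v (k + 1) →
      ¬ MohWindowSurfaceTameAt (r.E k).b ((r.A k).Z.presheaf.stalk (b k)) (stalkIdeal (r.E k).J (b k)) := by
    intro k hbk hle htame
    have htame' : ∀ ξ ∈ (r.D k : Set (r.A k).Z),
        MohWindowSurfaceTameAt (r.E k).b ((r.A k).Z.presheaf.stalk ξ) (stalkIdeal (r.E k).J ξ) := by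
      intro ξ hξ; rw [hcentre k hbk ξ hξ]; exact htame
    have hlt := (key k (r.E (k + 1)) (r.E_succ k) (hr (k + 1)) (hbS (k + 1))).2 hbk htame'
    exact absurd hle (not_le.mpr hlt)
  -- suppose every hit from `k₀` on drops
  by_contra hno
  push Not at hno
  have hdrop : ∀ k, k₀ ≤ k → b k ∈ (r.D k : Set (r.A k).Z) → v (k + 1) < v k := by
    intro k hk hbk
    by_contra hge
    exact hheavy k hbk (not_lt.mp hge) (hno k hk hbk (not_lt.mp hge))
  have hmono : ∀ k, k₀ ≤ k → v (k + 1) ≤ v k := by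
    intro k hk
    by_cases hbk : b k ∈ (r.D k : Set (r.A k).Z)
    · exact (hdrop k hk hbk).le
    · exact (htrans k hbk).le
  have hmono' : ∀ k, k₀ ≤ k → ∀ j, v (k + j) ≤ v k := by
    intro k hk j
    induction j with
    | zero => exact le_rfl
    | succ j ih => exact (hmono (k + j) (by omega)).trans ih
  have hacc : ∀ n, ∃ k, k₀ ≤ k ∧ v k + n ≤ v k₀ := by
    intro n
    induction n with
    | zero => exact ⟨k₀, le_rfl, by omega⟩
    | succ n ih =>
      obtain ⟨k, hk, hvk⟩ := ih
      obtain ⟨k', hkk', hbk'⟩ := hhit k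
      have h1 : v k' ≤ v k := by
        have := hmono' k hk (k' - k)
        rwa [Nat.add_sub_cancel' hkk'] at this
      have h2 := hdrop k' (hk.trans hkk') hbk'
      exact ⟨k' + 1, by omega, by omega⟩
  obtain ⟨k, -, hk⟩ := hacc (v k₀ + 1)
  omega

end CampaignW46

end Summit.ResolutionOfSingularities.ResolutionOfSingularities.Theorems

end
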